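import Literature.MathematicalPhysics.QuantumFieldTheory.Balaban1983to89.B7Prop1Explicit
import Summits.QuantumFields.BalabanUV.T4Continuum.Support.ScalarMassTower

/-!
# T⁴ programme, spine node NE2 (U1a) — F6 (ζ) on the route's carriers: BAŁABAN's BLOCK AVERAGE (15)/(42) ON THE TORUS BY PERIODISATION, AND THE PROPAGATION OF THE
# PLAQUETTE LETTER ALONG ONE AVERAGING STEP ([B7] Prop. 1 (51), transferred from `B7Prop1Explicit` on `ℤ^d`) (cell `pub-balaban-gaps`, seat ne2 gen 7)

The composed-remainder ENDs of this node (`ComposedRemainderGaugeTower…`) display a PLAQUETTE LETTER `p_{k,i}` for EVERY level `i` of every tower `U k`; in print the levels are the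
successive (15)-averages of the finest field and the letters propagate by [B7] Prop. 1 (51): `|V̄(∂p′) − 1| < L²α₀ + C₀(L²α₀)²`.  The tree proves (51) with explicit constants for the
concrete average (42) on `ℤ^d` (`B7Prop1Explicit.prop1_explicit`); the route's carriers are TORI `Tor (fine (L·N) M)` (cell `pub-balaban`'s DIVERGENCE F6 (ζ): no (15)-average on them).
THIS FILE supplies the average on the torus and transfers (51), by PERIODISATION:
 * §1 `castTor P : ℤ^d →+ Tor P` (coordinatewise `ℤ → ZMod (P μ)`), `liftCfg V` = the `P`-periodic lift of a torus bond configuration to `ℤ^d`; `castTor_e`, `castTor_natMul_e`;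
 * §2 translation covariance of [B7]'s objects on `ℤ^d` (`hol_shift`, `Wcx_shift`, `Xavg_shift`, **`bavg_shift`**: `V̄[V(· + v)](q) = V̄[V](q + v)`) ⟹ **`bavg_lift_congr`**: the average
   (42) of a periodic lift takes the same value at lattice points with the same residue;
 * §3 **`bavgTor L V`** `: Tor (fine N M) → Fin d → 𝔸ˣ` — (42) of the lift read at the representative `zrep y` of the coarse site (`castTor (zrep y) = cpt y`); the torus plaquette
   holonomy `tplaq`; **`tplaq_bavgTor`**: the coarse TORUS plaquette of `bavgTor V` IS [B7]'s `L`-plaquette `cplaq L (bavg L V̂) (zrep y)` of the lift (the wrap-around is a period: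
   `ScalarMassTower.cpt_add_unitVec`); **`hol_lift_plaqWord`**: the unit plaquettes of the lift ARE torus plaquettes;
 * §4 **`tplaq_bavgTor_sub_one_le`** — PROP. 1 ON THE TORUS: contractive-unit-valued `V` on `Tor (fine (L·N) M)` with `‖V(∂p) − 1‖ ≤ α₀` for all torus plaquettes and
   `512(d+1)(d+4)L²α₀ ≤ 1` ⟹ `‖V̄(∂p′) − 1‖ ≤ L²α₀ + 226·(8(d+1)(d+4)L²α₀)²` for every plaquette `p′` of the coarse torus `Tor (fine N M)`.
NOT here (next files): unitarity of `bavgTor V` for unitary `V` (needs the matrix logarithm's skew-hermiticity, `B7Prop2Explicit`), the iteration along a tower `U_i := V̄^{(k−i)}`, and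
the hookup with the commutator-form letters `hp` of the ENDs (`OneStepLoopHolonomy.norm_plaq_comm_eq`).
HONEST FRAMING (T4-DAG p. 1).  [B7] Prop. 1 is PRINTED and PROVED in the tree on `ℤ^d`; B7 prints no torus — the periodisation is this route's MODEL choice (finite tori `T⁴`); nothing of
Bałaban's asserted beyond print; `V` is DATA; NOT NE2; **NE2 (U1a) NOT PROVED**; spine PROVED 0/9 unchanged; NOT continuum YM / infinite volume / mass gap / Clay.  No `sorry`.
-/

noncomputable section

open scoped BigOperators

namespace Summit.QuantumFields.BalabanUV.T4Continuum.NE2.TorusBlockAveragePlaquette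

open Literature.MathematicalPhysics.QuantumFieldTheory.Balaban1983to89
open Literature.MathematicalPhysics.QuantumFieldTheory.Balaban1983to89.B7Prop1Explicit
  (Site Letter e hol stepHol plaqWord seg gammaWord treeWord revWord Wcx Xavg bavg cplaq U1 boxVec expUnit hol_cons hol_nil cplaq_one prop1_explicit)
open Literature.MathematicalPhysics.QuantumFieldTheory.Balaban1983to89.B5Prop11Plancherel (Tor fine unitVec)
open Literature.MathematicalPhysics.QuantumFieldTheory.Balaban1983to89.B5G183RateTorus (cpt)
open Literature.MathematicalPhysics.QuantumFieldTheory.Balaban1983to89.B5Block118 (tstep)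
open Summit.QuantumFields.BalabanUV.T4Continuum.ScalarMassTower (cpt_add_unitVec)

variable {d : ℕ}

/-! ## §1 The residue map `ℤ^d → Tor P` and the periodic lift of a torus configuration -/

section Cast

variable (P : Fin d → ℕ)

/-- the residue map `ℤ^d → T_P`, coordinatewise `ℤ → ZMod (P μ)`. [folklore] -/
def castTor : Site d →+ Tor P where
  toFun x := fun μ => ((x μ : ℤ) : ZMod (P μ))
  map_zero' := by funext μ; simp
  map_add' x y := by funext μ; simp

/-- entries of `castTor`. [folklore] -/
theorem castTor_apply (x : Site d) (μ : Fin d) : castTor P x μ = ((x μ : ℤ) : ZMod (P μ)) := rfl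

/-- `castTor e_μ = e_μ`. [folklore] -/
theorem castTor_e (μ : Fin d) : castTor P (e μ) = unitVec P μ := by
  funext ν
  by_cases h : ν = μ
  · subst h; simp [castTor_apply, B7Prop1Explicit.e_apply, unitVec]
  · simp [castTor_apply, B7Prop1Explicit.e_apply, unitVec, h]

/-- `castTor (t·e_μ) = t e_μ` (`tstep`). [folklore] -/
theorem castTor_natMul_e (μ : Fin d) (t : ℕ) : castTor P ((t : ℤ) • e μ) = tstep P μ t := by
  funext ν
  rw [castTor_apply, Pi.smul_apply, B7Prop1Explicit.e_apply, tstep]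
  split_ifs <;> simp

variable {P}

/-- the `P`-PERIODIC LIFT of a torus bond configuration to `ℤ^d`. [folklore] -/
def liftCfg {β : Type*} (V : Tor P → Fin d → β) : Site d → Fin d → β := fun x κ => V (castTor P x) κ

/-- entries of the lift. [folklore] -/
theorem liftCfg_apply {β : Type*} (V : Tor P → Fin d → β) (x : Site d) (κ : Fin d) : liftCfg V x κ = V (castTor P x) κ := rfl

end Cast

/-! ## §2 Translation covariance of [B7]'s lattice objects -/

section Shift

variable {G : Type*} [Group G]

/-- the translated configuration `V(· + v)`. [folklore] -/
def shiftCfg (W : Site d → Fin d → G) (v : Site d) : Site d → Fin d → G := fun x κ => W (x + v) κ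

/-- one letter of transport, translated. [folklore] -/
theorem stepHol_shift (W : Site d → Fin d → G) (v x : Site d) (l : Letter d) : stepHol (shiftCfg W v) x l = stepHol W (x + v) l := by
  unfold stepHol shiftCfg
  rw [add_right_comm]

/-- **parallel transport (9) is translation covariant**: `[V(· + v)](Γ from x) = V(Γ from x + v)`. [folklore] -/
theorem hol_shift (W : Site d → Fin d → G) (v : Site d) : ∀ (x : Site d) (w : List (Letter d)), hol (shiftCfg W v) x w = hol W (x + v) w
  | x, [] => by rw [hol_nil, hol_nil]
  | x, l :: w => by rw [hol_cons, hol_cons, stepHol_shift, hol_shift W v (x + l.vec) w, add_right_comm]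

end Shift

section ShiftAvg

variable {𝔸 : Type*} [NormedRing 𝔸] [NormOneClass 𝔸] [NormedAlgebra ℂ 𝔸] [CompleteSpace 𝔸] (L : ℕ)

omit [NormOneClass 𝔸] [NormedAlgebra ℂ 𝔸] [CompleteSpace 𝔸] in
/-- (42)'s loop variable, translated. [folklore] -/
theorem Wcx_shift (W : Site d → Fin d → 𝔸ˣ) (v q : Site d) (κ : Fin d) (r : Site d) : Wcx L (shiftCfg W v) q κ r = Wcx L W (q + v) κ r := by
  unfold Wcx; rw [hol_shift, hol_shift]

omit [NormOneClass 𝔸] [CompleteSpace 𝔸] in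
/-- (42)'s exponent, translated. [folklore] -/
theorem Xavg_shift (W : Site d → Fin d → 𝔸ˣ) (v q : Site d) (κ : Fin d) : Xavg L (shiftCfg W v) q κ = Xavg L W (q + v) κ := by
  unfold Xavg; simp_rw [Wcx_shift]

omit [NormOneClass 𝔸] in
/-- **the average (42) is translation covariant**: `V̄[V(· + v)](q) = V̄[V](q + v)`. [cite: Balaban1985Averaging, (42) p.23 (shape)] [folklore] -/
theorem bavg_shift (W : Site d → Fin d → 𝔸ˣ) (v q : Site d) (κ : Fin d) : bavg L (shiftCfg W v) q κ = bavg L W (q + v) κ := by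
  unfold bavg; rw [Xavg_shift, hol_shift]

variable {P : Fin d → ℕ}

omit [NormOneClass 𝔸] [NormedAlgebra ℂ 𝔸] [CompleteSpace 𝔸] in
/-- a lift is invariant under translation by a period vector. [folklore] -/
theorem shiftCfg_lift_of_castTor_eq_zero (V : Tor P → Fin d → 𝔸ˣ) {v : Site d} (hv : castTor P v = 0) : shiftCfg (liftCfg V) v = liftCfg V := by
  funext x κ
  simp only [shiftCfg, liftCfg_apply, map_add, hv, add_zero]

omit [NormOneClass 𝔸] in
/-- **the average of a periodic lift depends only on the residue of the base point**: `castTor q = castTor q′ ⟹ V̄(q) = V̄(q′)`. [folklore] -/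
theorem bavg_lift_congr (V : Tor P → Fin d → 𝔸ˣ) {q q' : Site d} (h : castTor P q = castTor P q') (κ : Fin d) :
    bavg L (liftCfg V) q κ = bavg L (liftCfg V) q' κ := by
  have hv : castTor P (q - q') = 0 := by rw [map_sub, h, sub_self]
  calc bavg L (liftCfg V) q κ = bavg L (liftCfg V) (q' + (q - q')) κ := by rw [add_sub_cancel]
    _ = bavg L (shiftCfg (liftCfg V) (q - q')) q' κ := (bavg_shift L _ _ _ _).symm
    _ = bavg L (liftCfg V) q' κ := by rw [shiftCfg_lift_of_castTor_eq_zero V hv]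

end ShiftAvg

/-! ## §3 The block average on the torus and its plaquettes -/

section Torus

variable {𝔸 : Type*} [NormedRing 𝔸] [NormOneClass 𝔸] [NormedAlgebra ℂ 𝔸] [CompleteSpace 𝔸]
variable (N L : ℕ) [NeZero N] [NeZero L] (M : Fin d → ℕ) [hM : ∀ μ, NeZero (M μ)]

/-- the lattice representative of a coarse torus site inside the fine lattice `ℤ^d`: `zrep y = L·val(y)` coordinatewise. [folklore] -/
def zrep (y : Tor (fine N M)) : Site d := fun μ => ((cpt N L M y μ).val : ℤ)

/-- `castTor (zrep y) = cpt y` (the coarse site as a fine torus site). [folklore] -/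
theorem castTor_zrep (y : Tor (fine N M)) : castTor (fine (L * N) M) (zrep N L M y) = cpt N L M y := by
  funext μ
  rw [castTor_apply, zrep, Int.cast_natCast, ZMod.natCast_zmod_val]

/-- **BAŁABAN's BLOCK AVERAGE (15)/(42) ON THE TORUS**: `V̄_c` for the coarse torus bond `c = ⟨y, y + e_κ⟩` of `Tor (fine N M)` is [B7]'s average (42) of the periodic lift of `V`, read at the
representative `zrep y` (any representative gives the same value, `bavg_lift_congr`). [cite: Balaban1985Averaging, (15) p.19, (42) p.23 (shape)] [folklore] -/
def bavgTor (V : Tor (fine (L * N) M) → Fin d → 𝔸ˣ) : Tor (fine N M) → Fin d → 𝔸ˣ := fun y κ => bavg L (liftCfg V) (zrep N L M y) κ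

omit [NormOneClass 𝔸] in
/-- `bavgTor` through any representative. [folklore] -/
theorem bavgTor_eq_of_castTor (V : Tor (fine (L * N) M) → Fin d → 𝔸ˣ) {q : Site d} {y : Tor (fine N M)} (h : castTor (fine (L * N) M) q = cpt N L M y) (κ : Fin d) :
    bavgTor N L M V y κ = bavg L (liftCfg V) q κ := by
  unfold bavgTor
  exact bavg_lift_congr L V (by rw [castTor_zrep, h]) κ

/-- the representative of the next coarse site differs from `zrep y + L·e_μ` by a period. [folklore] -/
theorem castTor_zrep_add_unitVec (y : Tor (fine N M)) (μ : Fin d) :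
    castTor (fine (L * N) M) (zrep N L M y + ((L : ℕ) : ℤ) • e μ) = cpt N L M (y + unitVec (fine N M) μ) := by
  rw [map_add, castTor_zrep, castTor_natMul_e, cpt_add_unitVec]

variable {Q : Fin d → ℕ}

/-- the plaquette holonomy of a torus bond configuration: `W(∂p) = W(y, μ) W(y + e_μ, ν) W(y + e_ν, μ)⁻¹ W(y, ν)⁻¹`. [cite: Balaban1985Averaging, (44) p.24 (shape)] [folklore] -/
def tplaq {G : Type*} [Group G] (W : Tor Q → Fin d → G) (y : Tor Q) (μ ν : Fin d) : G :=
  W y μ * W (y + unitVec Q μ) ν * (W (y + unitVec Q ν) μ)⁻¹ * (W y ν)⁻¹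

omit [NormOneClass 𝔸] in
/-- **THE COARSE TORUS PLAQUETTE OF THE AVERAGE IS [B7]'s `L`-PLAQUETTE OF THE LIFT** (wrap-around = a period). [folklore] -/
theorem tplaq_bavgTor (V : Tor (fine (L * N) M) → Fin d → 𝔸ˣ) (y : Tor (fine N M)) (μ ν : Fin d) :
    tplaq (bavgTor N L M V) y μ ν = cplaq L (bavg L (liftCfg V)) (zrep N L M y) μ ν := by
  unfold tplaq cplaq
  rw [bavgTor_eq_of_castTor N L M V (castTor_zrep_add_unitVec N L M y μ), bavgTor_eq_of_castTor N L M V (castTor_zrep_add_unitVec N L M y ν)]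
  rfl

omit [NormOneClass 𝔸] [NormedAlgebra ℂ 𝔸] [CompleteSpace 𝔸] in
/-- **THE UNIT PLAQUETTES OF THE LIFT ARE TORUS PLAQUETTES**. [folklore] -/
theorem hol_lift_plaqWord (V : Tor Q → Fin d → 𝔸ˣ) (x : Site d) (κ κ' : Fin d) :
    hol (liftCfg V) x (plaqWord κ κ') = tplaq V (castTor Q x) κ κ' := by
  rw [← cplaq_one]
  unfold cplaq tplaq
  simp only [liftCfg_apply, map_add, one_smul, Nat.cast_one, castTor_e]

/-! ## §4 Proposition 1 on the torus -/

/-- **[B7] PROPOSITION 1 (51) ON THE TORUS, BY PERIODISATION**: for a contractive-unit-valued bond configuration `V` on the fine torus `Tor (fine (L·N) M)` whose plaquette holonomies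
satisfy `‖V(∂p) − 1‖ ≤ α₀`, and `512(d+1)(d+4)L²α₀ ≤ 1`, every plaquette of the block average on the coarse torus satisfies
`‖V̄(∂p′) − 1‖ ≤ L²α₀ + 226·(8(d+1)(d+4)L²α₀)²` — the plaquette letter propagates along one averaging step with the factor `L²` (+ quadratic corrections).
[cite: Balaban1985Averaging, Prop. 1 (51) p.26] [folklore] -/
theorem tplaq_bavgTor_sub_one_le (hL : 1 ≤ L) (V : Tor (fine (L * N) M) → Fin d → 𝔸ˣ) (hV : ∀ y κ, V y κ ∈ U1 𝔸) {α₀ : ℝ} (hα₀ : 0 ≤ α₀)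
    (hsmall : 512 * (d + 1) * (d + 4) * (L : ℝ) ^ 2 * α₀ ≤ 1)
    (h44 : ∀ (y : Tor (fine (L * N) M)) (κ κ' : Fin d), κ ≠ κ' → ‖((tplaq V y κ κ' : 𝔸ˣ) : 𝔸) - 1‖ ≤ α₀)
    (y : Tor (fine N M)) {μ ν : Fin d} (hμν : μ ≠ ν) :
    ‖((tplaq (bavgTor N L M V) y μ ν : 𝔸ˣ) : 𝔸) - 1‖ ≤ (L : ℝ) ^ 2 * α₀ + 226 * (8 * (d + 1) * (d + 4) * (L : ℝ) ^ 2 * α₀) ^ 2 := by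
  rw [tplaq_bavgTor]
  exact prop1_explicit L hL (zrep N L M y) hμν (liftCfg V) (fun x κ => hV _ κ) hα₀ hsmall
    (fun x κ κ' hκ => by rw [hol_lift_plaqWord]; exact h44 _ κ κ' hκ)

end Torus

end Summit.QuantumFields.BalabanUV.T4Continuum.NE2.TorusBlockAveragePlaquette

end
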